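import Literature.MathematicalPhysics.QuantumFieldTheory.Balaban1983to89.Node00.N24GlueStage13C
import Literature.MathematicalPhysics.QuantumFieldTheory.Balaban1983to89.Node00.Record13CoP

/-!
# NODE N24 · (B2) `B16.EndStatementBPrinted D.C` AT NODE 00's bg-free Co STAGE-13 RECORD (print's background, director-ym №152 (β)) `IsRecordOfRecord₁₃CCoP` (node00-def-T FILE 23 `Node00/Record13CoP.lean`, v1.5): THE ENGINE
# THROUGH THE SHADOW (`D₅.C = D.C`), THE θ-KEYED CARRIER SOCKETS OVER `θ.toStage5₁₃CoP`, THE β-BINDERS AT THE MERGED β OVER `(TcanOfRecord, chiFixed29)`, THE K1-CLASS ITEM's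
# (D, w)-SHAPE — module 37 (‴ `N24GlueStage13C` p489281, ⁗ `N24GlueStage13CSep` p503995) STATED ONCE OVER `Provisos₁₃Core ∕ datumOfRecord₁₃CoP ∕ IsRecordOfRecord₁₃CCoP`

TRACK A (YM-PLAN §2d, node N24 of 28 = binder B2 `hB : B16.EndStatementBPrinted D.C`), seat `pub-ymgap-dag-n24-c` (R134 fan-out seat, strategy s2; gen 5).
THE v1.5 `CoP` EDITION — RECORD 13 AT PRINT's BACKGROUND `UbgOfRecord₁₃CoP` (node00-def-R `UbgMSCoPOfRecord` over [15] p.277's Ω₀ = Ω₁ + M₁-collar, FILE 22′ p519921) WITH PRINT's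
ζ0-ONLY 𝐓-WEIGHTS `WtOfRecord₁₃P` (node00-def-T 12a″ `TkWeightsOfRecordP` p519608) — director-ym LINE №152 (β) + №160 F7 ∕ №162 (y) after FINDING №7 (n11-d `not_tLaw₁₃_zero`:
on ≤ v1.4 the (S1ᵀ) slot `SLaw → TLaw` of every hT-face was unsatisfiable at k = 0 via 12a's `chiRegW` on `Ω₁ᶜ`; F7 re-ranges that weight — satisfiability at k = 0 is NOT asserted here);
node00-def-T FILE 23 `Node00/Record13CoP.lean` p520810, KEY-23 = «v1.4 tokens + `Co ↦ CoP`»; = this seat's LANDED (β) Co edition p516319 ∕ p516602 ∕ p517449 ∕ p519168 ∕ p518708 under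
KEY-23, proofs verbatim — AND EDITION-FREE OVER THE PROVISO EDITIONS (def-T ∕ №152 §4 «key ONCE, on Core(Co), where you read no
proviso row»).  N24's Stage-13 surface (modules 37–44: ‴ v1.1-keyed, ⁗ v1.2 `Sep`-keyed, the ⁵ `SepMixed` prestage — all at the tree's former background `UbgOfRecord₁₃`) reads NO proviso
row of node00-def-T's RECORD 13 except the CORE rows `rstep` ∕ `tstep` (through the datum, and on the live line to feed dag-n11-e's (D) chain and node00-def-K0a's slots lemma); hence
every NON-item-facing theorem is stated ONCE here, over the background-free core key `Stage13Params.Provisos₁₃Core` (UNCHANGED, `Node00/Record13.lean` v1.2 §9) and def-T's Co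
objects of record — laws `SLaw₁₃CoP ∕ TLaw₁₃CoP`, 𝐑-carrier `VOfRecord₁₃CoP`, Stage-5 view `Stage13Params.toStage5₁₃CoP`, machine core `coreOfRecord₁₃CoP`, tower ∕ datum
`towerOfRecord₁₃CoP ∕ datumOfRecord₁₃CoP (θ) (h : θ.Provisos₁₃Core F N)`, the bg-free Co RECORD FAMILY `IsRecordOfRecord₁₃CCoP` with its pointed form, shadow ∕ transfer block and
`endStatementBPrinted_of_isRecordOfRecord₁₃CCoP_of_nodes` (FILE 23; the density `densOfRecord₁₃`, the histories `gOfRecord₁₃`, `betaOfRecord₁₃`, `EOfRecord₁₃`, the (2.9) species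
`chiβOfRecord₁₃` and `wilsonBGOfRecord` are background-FREE and unchanged) — and serves EVERY proviso edition E over that background (v1.5 `Provisos₁₃SepCoP` — def-T FILE 24T
`Node00/Record13SepCoP.lean` — and its successors) AT `hP.toCore` (def-T's one-way map `Provisos₁₃E.toCore`, record projection `IsRecordOfRecord₁₃CE.toCoP`; datum bridge
`datumOfRecord₁₃E F N θ h = datumOfRecord₁₃CoP F N θ h.toCore` by `rfl`).  Only the ITEM-FACING theorems — K1's θ-keyed consequent `∃ θ' (h' : θ'.Provisos₁₃E F N), …` and the
registered rung bodies concluding `IsRecordOfRecord₁₃CE …` — stay per edition, in ONE thin module per edition whose proofs are the 3-line packagings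
`⟨θ, hP, …, <Co engine> … hP.toCore …, window⟩` of the engines below (this seat's `N24ItemsStage13SepCoP`).  A Co record has NO background ROW (only the background OBJECT in its §2
form): on its own it discharges nothing of (B) — the (B)-side inputs are HYPOTHESES here exactly as in every edition.
A NEW importing module (imports module 37 `Node00.N24GlueStage13C` — whence module 23's Stage-5 engine `N24_at_record₅C` ∕ `N24_at_record₅C_of_N13_exists` ∕ `N03_at_record₅C` ∕
`N24_b16_main_withExp_of_cor3Leaves₅C` ∕ `N24_leaves_iff_binders₅C`, module 8's window, module 37's (T, χ)-GENERIC merged-β iffs `N24_betaLowerH_iff_mergedTχ` ∕ `N24_betaUpperH_iff_mergedTχ`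
(θ-level, served VERBATIM, not re-declared) — and def-T's `Node00.Record13Core`).  THEOREMS ONLY, def-free, sorry-free, standard axioms.  = module 37 §0–§5 (via its ⁗ edition) under
`θ.Provisos₁₃Sep ↦ θ.Provisos₁₃Core`, `datumOfRecord₁₃Sep ↦ datumOfRecord₁₃CoP`, `IsRecordOfRecord₁₃CSep ↦ IsRecordOfRecord₁₃CCoP` (def-T's Co faces `atWorld_of_isRecordOfRecord₁₃CCoP`,
`exists_isRecordOfRecord₅C_of_isRecordOfRecord₁₃CCoP`, `gamma_pos_of_isRecordOfRecord₁₃CCoP`, `βfun_datumOfRecord₁₃CoP` BY NAME; `rOperation_upOfRecord₅C_stage13CoP_iff` is θ-level and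
UNCHANGED), own stems `…₁₃CSep… ↦ …₁₃CCoP…`, `…merged₁₃Sep ↦ …merged₁₃CoP`; every proof term is module 37's.

WHAT THIS FILE PROVES (23 theorems).
§0 θ-keyed pinned carrier SOCKETS over `θ.toStage5₁₃CoP` ↔ the world's leaves (`N24_forall_pinned_b8Leaf_iff₁₃CCoP` ∕ `…b9…` ∕ `…b11…` ∕ `…b15…` ∕ `N24_forall_pinned_rOperation_iff₁₃CCoP`);
   N03 a theorem at ₁₃CCoP (`N24_b6_main_of_isRecordOfRecord₁₃CCoP`); the carrier children from their sockets (`N24_b8∕b9∕b11∕b10∕b13∕b15_main_of_isRecordOfRecord₁₃CCoP_of_slot`).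
§1 the ENGINE `N24_at_record₁₃CCoP` (nine by-name binders N05 … N13 + β-box ⇒ (B2), through the shadow `exists_isRecordOfRecord₅C_of_isRecordOfRecord₁₃CCoP`),
   `N24_at_record₁₃CCoP_of_N13_exists`, `N24_at_record₁₃CCoP_of_N13_leaf` (N13 world-level `hR` + `hcor3`), **`N24_at_record₁₃CCoP_knit_pinned`** (carrier children at θ by name,
   N09 ∕ N11 binders, N13 world-level — the Co junction enters in the sequel `N24KnitStage13AllCoP`).
§2 `N24_betaLowerH_iff_merged₁₃CoP` ∕ `N24_betaUpperH_iff_merged₁₃CoP` (at a Core-keyed Co presentation), `N24_at_record₁₃CCoP_knit_of_betaMerged_pinned`.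
§3 the K1-class item's (D, w)-body in its literal shape at a Co ₁₃C record: `N24_stabilityBR13_shape₁₃CCoP_knit_pinned` (`IsRecordOfRecord₁₃CCoP F N D w ∧ (B) ∧ window`, witnessed by
   the record at hand; window from `hhi` alone by module 8's `N24_window_allK_of_betaUpperH`), `N24_stabilityBR13_consequent₁₃CCoP_knit_pinned` (∃-form).  (K1's registered θ-KEYED
   text is per edition — NOT stated here; see the edition's thin module.)
§4 `N24_isRecordOfRecord₁₃CCoP_reletter` (₁₃CCoP closed under γ-lowering re-lettering); §5 `N24_leaves_iff_binders₁₃CCoP` (the socket display is strength-neutral).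

VACUITY ∕ A1.  The K0-class inhabitation item is OWED per edition; every theorem below is a per-record implication; a ∀-form over ₁₃CCoP is NOT-A-DISCHARGE.
HONEST FRAMING: kernel bookkeeping BY NAME; nothing of Bałaban's asserted; every slot DISPLAYED; N24 COMPOSITE — no discharge, no count moved (5∕27), no stub closed; one finite T⁴
programme at fixed ε; NOT continuum ∕ ℝ⁴ ∕ OS ∕ mass gap ∕ Clay.
-/

noncomputable section

open scoped Matrix.Norms.L2Operator

namespace Literature.MathematicalPhysics.QuantumFieldTheory.Balaban1983to89.Node00

open DagBinding T4Continuum T4DatumAssembly FlowStepRuns AveragingRT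
open FlowStep (box_mono)

variable {F : T4Family} {N : ℕ} [NeZero N] {D : FiniteEpsData F (SU N)} {w : WorldP}

/-! ## §0. θ-keyed pinned carrier sockets over `θ.toStage5₁₃CoP` ↔ the world's leaves; N03 a theorem at ₁₃CCoP; the carrier children from their sockets -/

/-- **The θ-keyed [B8] socket IS the world's leaf** at a Co ₁₃C record: «for the admissible Stage-13 parameters with their provisos presenting the datum and binding the
world over their Stage-13 view, the [B8] leaf `B8LeafR` over the [B8] group of the RESIDUAL bundle `θ.res.X P`» ↔ `∀ P, (w.up P).b8` (`upOfRecord₅C_b8_b9_b11` at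
`θ.toStage5₁₃CoP F N`, whose `X` group IS `θ.res.X`, `rfl`). [cite: Balaban1985RegularSpaces, Lemma 1 – Thm 8 pp.79–101 (the leaf; bookkeeping: the pinned socket at Stage 13)] -/
theorem N24_forall_pinned_b8Leaf_iff₁₃CCoP (h : IsRecordOfRecord₁₃CCoP F N D w) :
    (∀ (θ : Stage13Params F N) (hP : θ.Provisos₁₃Core F N), θ.Admissible F N → D = datumOfRecord₁₃CoP F N θ hP →
        (∀ P, w.up P = upOfRecord₅C F N (θ.toStage5₁₃CoP F N) P) → ∀ P : B12.RunParams,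
        B8LeafR (θ.res.X P).d8 (θ.res.X P).L8 (θ.res.X P).C₂ (θ.res.X P).B₁' (θ.res.X P).B₀' (θ.res.X P).B₁ (θ.res.X P).B₂ (θ.res.X P).c₁
          (θ.res.X P).inp8 (θ.res.X P).B₀β (θ.res.X P).loc8 (θ.res.X P).fam8R (θ.res.X P).lan8 (θ.res.X P).cub8 (θ.res.X P).toAxial8) ↔
      ∀ P : B12.RunParams, (w.up P).b8 := by
  refine ⟨fun hX P => ?_, fun hw θ' hP' _ _ hup' P => ?_⟩
  · obtain ⟨θ, hP, hθ, hD, -, -, -, hup⟩ := h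
    rw [hup P]
    exact (B11LeafUnpinnedRecord.upOfRecord₅C_b8_b9_b11 (θ.toStage5₁₃CoP F N) P).1.2 (hX θ hP hθ hD hup P)
  · have h8 : (w.up P).b8 := hw P
    rw [hup' P] at h8
    exact (B11LeafUnpinnedRecord.upOfRecord₅C_b8_b9_b11 (θ'.toStage5₁₃CoP F N) P).1.1 h8

/-- **The θ-keyed [B9] socket IS the world's leaf** at a Co ₁₃C record: «… `B9LeafX (θ.res.Y P)`» ↔ `∀ P, (w.up P).b9` (the `Y` group is residual at Stage 13).
[cite: Balaban1985BackgroundPropagators, Thms 3.1–3.15 pp.397–432 (the leaf; bookkeeping: the pinned socket at Stage 13)] -/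
theorem N24_forall_pinned_b9Leaf_iff₁₃CCoP (h : IsRecordOfRecord₁₃CCoP F N D w) :
    (∀ (θ : Stage13Params F N) (hP : θ.Provisos₁₃Core F N), θ.Admissible F N → D = datumOfRecord₁₃CoP F N θ hP →
        (∀ P, w.up P = upOfRecord₅C F N (θ.toStage5₁₃CoP F N) P) → ∀ P : B12.RunParams, B9LeafX (θ.res.Y P)) ↔
      ∀ P : B12.RunParams, (w.up P).b9 := by
  refine ⟨fun hY P => ?_, fun hw θ' hP' _ _ hup' P => ?_⟩
  · obtain ⟨θ, hP, hθ, hD, -, -, -, hup⟩ := h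
    rw [hup P]
    exact (B11LeafUnpinnedRecord.upOfRecord₅C_b8_b9_b11 (θ.toStage5₁₃CoP F N) P).2.1.2 (hY θ hP hθ hD hup P)
  · have h9 : (w.up P).b9 := hw P
    rw [hup' P] at h9
    exact (B11LeafUnpinnedRecord.upOfRecord₅C_b8_b9_b11 (θ'.toStage5₁₃CoP F N) P).2.1.1 h9

/-- **The θ-keyed [B11] socket IS the world's leaf** at a Co ₁₃C record: «… `B11Leaf (θ.res.Z P)`» ↔ `∀ P, (w.up P).b11` (the `Z` group is residual at Stage 13).
[cite: Balaban1985Variational, Thm 1 p.279, Props 2–9 pp.281–309 (the leaf; bookkeeping: the pinned socket at Stage 13)] -/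
theorem N24_forall_pinned_b11Leaf_iff₁₃CCoP (h : IsRecordOfRecord₁₃CCoP F N D w) :
    (∀ (θ : Stage13Params F N) (hP : θ.Provisos₁₃Core F N), θ.Admissible F N → D = datumOfRecord₁₃CoP F N θ hP →
        (∀ P, w.up P = upOfRecord₅C F N (θ.toStage5₁₃CoP F N) P) → ∀ P : B12.RunParams, B11Leaf (θ.res.Z P)) ↔
      ∀ P : B12.RunParams, (w.up P).b11 := by
  refine ⟨fun hZ P => ?_, fun hw θ' hP' _ _ hup' P => ?_⟩
  · obtain ⟨θ, hP, hθ, hD, -, -, -, hup⟩ := h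
    rw [hup P]
    exact (B11LeafUnpinnedRecord.upOfRecord₅C_b8_b9_b11 (θ.toStage5₁₃CoP F N) P).2.2.2 (hZ θ hP hθ hD hup P)
  · have h11 : (w.up P).b11 := hw P
    rw [hup' P] at h11
    exact (B11LeafUnpinnedRecord.upOfRecord₅C_b8_b9_b11 (θ'.toStage5₁₃CoP F N) P).2.2.1 h11

/-- **The θ-keyed [IV] socket IS the world's leaf** at a Co ₁₃C record: «… `B15Leaf (θ.res.W P)`» ↔ `∀ P, (w.up P).rBasicStep` (the `W` group is residual at Stage 13).
[cite: Balaban1989LargeFieldI, Prop. 1 p.194, (0.4)–(0.6) p.176 (the leaf; bookkeeping: the pinned socket at Stage 13)] -/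
theorem N24_forall_pinned_b15Leaf_iff₁₃CCoP (h : IsRecordOfRecord₁₃CCoP F N D w) :
    (∀ (θ : Stage13Params F N) (hP : θ.Provisos₁₃Core F N), θ.Admissible F N → D = datumOfRecord₁₃CoP F N θ hP →
        (∀ P, w.up P = upOfRecord₅C F N (θ.toStage5₁₃CoP F N) P) → ∀ P : B12.RunParams, B15Leaf (θ.res.W P)) ↔
      ∀ P : B12.RunParams, (w.up P).rBasicStep := by
  refine ⟨fun hW P => ?_, fun hw θ' hP' _ _ hup' P => ?_⟩
  · obtain ⟨θ, hP, hθ, hD, -, -, -, hup⟩ := h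
    rw [hup P]
    exact (B15LeafKnitRecord7.rBasicStep_upOfRecord₅C_iff (θ.toStage5₁₃CoP F N) P).2 (hW θ hP hθ hD hup P)
  · have h15 : (w.up P).rBasicStep := hw P
    rw [hup' P] at h15
    exact (B15LeafKnitRecord7.rBasicStep_upOfRecord₅C_iff (θ'.toStage5₁₃CoP F N) P).1 h15

/-- **The record's 𝐑-leaf IS «𝐓-image form ⇒ §2 form one level up» along the Stage-13 tower of record** (N13's (R) slot at the objects of record, seat node00-def-T's
`Record12.rOperation_upOfRecord₅C_stage13CoP_iff` ∕ `exists_rOperation_iff_of_isRecordOfRecord₁₃CCoP`, displayed as a socket): at a Co ₁₃C record, «for the presenting parameters,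
`∀ k < K, TLaw₁₃CoP θ P k → SLaw₁₃CoP θ P (k+1)` at every run» ↔ `∀ P, (w.up P).rOperation` — the hypothesis `hR` of §1's knit.  AT STAGE 12 THE FORMAT IS PINNED AND REPAIRED:
`SLaw₁₃CoP ∕ TLaw₁₃CoP` READ the §2 [Balaban1988Convergent] form of record `S218OfRecord₁₃CoP ∕ ScorrLawOfRecord₁₃CoP` (representation ∧ `HasSect2FormAEZ` ∕ `HasSect2FormTAEZ` — the
by-value dichotomy «slot = 0 ∨ (2.18) identity a.e.» — at the slot families of the represented tower, def-R's background maps with the level-0 map `𝐖 ↦ 𝐖 0`, and the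
𝐓-weights of record) at `densOfRecord₁₃ ∕ tdensOfRecord₁₃` — Theorem 2's statement shape at the objects of record (nothing of it asserted; the base
`SLaw₁₃CoP θ P 0` is the record's theorem `sLaw₁₃CoP_zero`).
[cite: Balaban1988Convergent, p.244 and remark p.262, Def. 3 p.279; Balaban1989LargeFieldII, Thm 1 p.355 (the 𝐑-leaf; bookkeeping at the Stage-13 record)] -/
theorem N24_forall_pinned_rOperation_iff₁₃CCoP (h : IsRecordOfRecord₁₃CCoP F N D w) :
    (∀ (θ : Stage13Params F N) (hP : θ.Provisos₁₃Core F N), θ.Admissible F N → D = datumOfRecord₁₃CoP F N θ hP →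
        (∀ P, w.up P = upOfRecord₅C F N (θ.toStage5₁₃CoP F N) P) →
        ∀ P : B12.RunParams, ∀ k, k < P.K → TLaw₁₃CoP F N θ P k → SLaw₁₃CoP F N θ P (k + 1)) ↔
      ∀ P : B12.RunParams, (w.up P).rOperation := by
  refine ⟨fun hT P => ?_, fun hw θ' hP' _ _ hup' P => ?_⟩
  · obtain ⟨θ, hP, hθ, hD, -, -, -, hup⟩ := h
    rw [hup P]
    exact (rOperation_upOfRecord₅C_stage13CoP_iff F N θ P).2 (hT θ hP hθ hD hup P)
  · have hR : (w.up P).rOperation := hw P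
    rw [hup' P] at hR
    exact (rOperation_upOfRecord₅C_stage13CoP_iff F N θ' P).1 hR

/-- **N03 · [Balaban1984PropagatorsII] IS A THEOREM AT EVERY RUN OF EVERY STAGE-13 RECORD** (seat dag-n03-a's `N03_at_record₅C`, chair R443, transferred through the
shadow by `atWorld_of_isRecordOfRecord₁₃CCoP`). [cite: Balaban1984PropagatorsII, Lemma 2.1 – Cor. 2.8 pp.223–250 (kernel version of the lineage, transferred)] -/
theorem N24_b6_main_of_isRecordOfRecord₁₃CCoP (h : IsRecordOfRecord₁₃CCoP F N D w) (P : B12.RunParams) : Dag.B6_main (leavesP w P) :=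
  atWorld_of_isRecordOfRecord₁₃CCoP (fun _ _ h5 P => N03_at_record₅C h5 P) h P

/-- **N05 · [Balaban1985RegularSpaces] at every run of a Co ₁₃C record from the θ-keyed [B8] socket** (`B8LeafKnit.b8_main_of_leaf`).
[cite: Balaban1985RegularSpaces, Thm 2 p.83, Thm 4 p.88, Thm 8 p.101 (node bookkeeping at the Stage-13 record)] -/
theorem N24_b8_main_of_isRecordOfRecord₁₃CCoP_of_slot (h : IsRecordOfRecord₁₃CCoP F N D w)
    (slots₀₅ : ∀ (θ : Stage13Params F N) (hP : θ.Provisos₁₃Core F N), θ.Admissible F N → D = datumOfRecord₁₃CoP F N θ hP →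
      (∀ P, w.up P = upOfRecord₅C F N (θ.toStage5₁₃CoP F N) P) → ∀ P : B12.RunParams,
        B8LeafR (θ.res.X P).d8 (θ.res.X P).L8 (θ.res.X P).C₂ (θ.res.X P).B₁' (θ.res.X P).B₀' (θ.res.X P).B₁ (θ.res.X P).B₂ (θ.res.X P).c₁
          (θ.res.X P).inp8 (θ.res.X P).B₀β (θ.res.X P).loc8 (θ.res.X P).fam8R (θ.res.X P).lan8 (θ.res.X P).cub8 (θ.res.X P).toAxial8)
    (P : B12.RunParams) : Dag.B8_main (leavesP w P) :=
  B8LeafKnit.b8_main_of_leaf w P ((N24_forall_pinned_b8Leaf_iff₁₃CCoP h).1 slots₀₅ P)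

/-- **N06 · [Balaban1985BackgroundPropagators] at every run of a Co ₁₃C record from the θ-keyed [B9] socket** (in-edges unused).
[cite: Balaban1985BackgroundPropagators, Thms 3.1–3.15 pp.397–432 (node bookkeeping at the Stage-13 record)] -/
theorem N24_b9_main_of_isRecordOfRecord₁₃CCoP_of_slot (h : IsRecordOfRecord₁₃CCoP F N D w)
    (slots₀₆ : ∀ (θ : Stage13Params F N) (hP : θ.Provisos₁₃Core F N), θ.Admissible F N → D = datumOfRecord₁₃CoP F N θ hP →
      (∀ P, w.up P = upOfRecord₅C F N (θ.toStage5₁₃CoP F N) P) → ∀ P : B12.RunParams, B9LeafX (θ.res.Y P))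
    (P : B12.RunParams) : Dag.B9_main (leavesP w P) :=
  fun _ _ _ _ => (N24_forall_pinned_b9Leaf_iff₁₃CCoP h).1 slots₀₆ P

/-- **N07 · [Balaban1985Variational] at every run of a Co ₁₃C record from the θ-keyed [B11] socket** (`B11LeafUnpinnedRecord.b11_main_of_upOfRecord₅C_of_b11Leaf` at the
Stage-13 view). [cite: Balaban1985Variational, Thm 1 p.279, Props 2–9 pp.281–309 (node bookkeeping at the Stage-13 record)] -/
theorem N24_b11_main_of_isRecordOfRecord₁₃CCoP_of_slot (h : IsRecordOfRecord₁₃CCoP F N D w)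
    (slots₀₇ : ∀ (θ : Stage13Params F N) (hP : θ.Provisos₁₃Core F N), θ.Admissible F N → D = datumOfRecord₁₃CoP F N θ hP →
      (∀ P, w.up P = upOfRecord₅C F N (θ.toStage5₁₃CoP F N) P) → ∀ P : B12.RunParams, B11Leaf (θ.res.Z P))
    (P : B12.RunParams) : Dag.B11_main (leavesP w P) := by
  obtain ⟨θ, hP, hθ, hD, -, -, -, hup⟩ := h
  exact B11LeafUnpinnedRecord.b11_main_of_upOfRecord₅C_of_b11Leaf (θ.toStage5₁₃CoP F N) P (hup P) (slots₀₇ θ hP hθ hD hup P)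

/-- **N08 · [Balaban1985UV3] (compact reading of record, chair R434) at every run of a Co ₁₃C record from the θ-keyed leaf-system slot**: the residual [B10] run family of
`θ.res.X P` is a family of leaf-system tower runs (`B10LeafUnpinnedRecord5C.b10_main_of_upOfRecord₅C_of_leafSystems` at the Stage-13 view; the [B10] carrier pin at
Stage 13 awaits node00-def's `Record12Carriers`). [cite: Balaban1985UV3, Thm 1 p.257 (compact reading) + Thm 2 p.272 (node bookkeeping at the Stage-13 record)] -/
theorem N24_b10_main_of_isRecordOfRecord₁₃CCoP_of_slot (h : IsRecordOfRecord₁₃CCoP F N D w)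
    (slots₀₈ : ∀ (θ : Stage13Params F N) (hP : θ.Provisos₁₃Core F N), θ.Admissible F N → D = datumOfRecord₁₃CoP F N θ hP →
      (∀ P, w.up P = upOfRecord₅C F N (θ.toStage5₁₃CoP F N) P) → ∀ P : B12.RunParams,
        ∃ (Xc : PrintedCarriersR) (I : Type) (C : B10Assembly.Consts) (T : I → B10.TowerRun),
          Nonempty (∀ i, B10Assembly.LeafSystem C (T i)) ∧ θ.res.X P = Xc.withTowerRuns10 T)
    (P : B12.RunParams) : Dag.B10_main (leavesP w P) := by
  obtain ⟨θ, hP, hθ, hD, -, -, -, hup⟩ := h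
  obtain ⟨Xc, I, C, T, ⟨S⟩, hX⟩ := slots₀₈ θ hP hθ hD hup P
  exact B10LeafUnpinnedRecord5C.b10_main_of_upOfRecord₅C_of_leafSystems (θ.toStage5₁₃CoP F N) (hup P) Xc S hX

/-- **N10 · [Balaban1988RG2Cluster] at every run of a Co ₁₃C record from the θ-keyed B13 socket** over the residual groups X ([B10] runs, B12, B13), Y, Z
(`B13NodeKnitRecord5C.b13_main_at_stage5ParamsC` at the Stage-13 view). [cite: Balaban1988RG2Cluster, Lemmas 1–3 pp.9, 11, 20 (node bookkeeping at the Stage-13 record)] -/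
theorem N24_b13_main_of_isRecordOfRecord₁₃CCoP_of_slot (h : IsRecordOfRecord₁₃CCoP F N D w)
    (slots₁₀ : ∀ (θ : Stage13Params F N) (hP : θ.Provisos₁₃Core F N), θ.Admissible F N → D = datumOfRecord₁₃CoP F N θ hP →
      (∀ P, w.up P = upOfRecord₅C F N (θ.toStage5₁₃CoP F N) P) → ∀ P : B12.RunParams,
        B9LeafX (θ.res.Y P) →
          (B10.Thm1PrintedCompact (θ.res.X P).runs10 ∧ B10.Thm2Printed (θ.res.X P).runs10) →
            B11Leaf (θ.res.Z P) → B12Sec2to5.Lemma4Printed (θ.res.X P).F12 (θ.res.X P).c12 →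
              B13.Lemma1Printed (θ.res.X P).S13 (θ.res.X P).c13 ∧ B13.Lemma2Printed (θ.res.X P).S13 (θ.res.X P).c13 ∧
                B13.Lemma3Printed (θ.res.X P).S13 (θ.res.X P).c13)
    (P : B12.RunParams) : Dag.B13_main (leavesP w P) := by
  obtain ⟨θ, hP, hθ, hD, -, -, -, hup⟩ := h
  exact B13NodeKnitRecord5C.b13_main_at_stage5ParamsC F N (θ.toStage5₁₃CoP F N) w P (hup P) (slots₁₀ θ hP hθ hD hup P)

/-- **N12 · [Balaban1989LargeFieldI] at every run of a Co ₁₃C record from the θ-keyed [IV] socket** (`B15LeafKnit.b15_main_of_up`).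
[cite: Balaban1989LargeFieldI, Prop. 1 p.194, (1.80) p.195, (1.89) p.198, (1.99)–(1.100) p.201 (node bookkeeping at the Stage-13 record)] -/
theorem N24_b15_main_of_isRecordOfRecord₁₃CCoP_of_slot (h : IsRecordOfRecord₁₃CCoP F N D w)
    (slots₁₂ : ∀ (θ : Stage13Params F N) (hP : θ.Provisos₁₃Core F N), θ.Admissible F N → D = datumOfRecord₁₃CoP F N θ hP →
      (∀ P, w.up P = upOfRecord₅C F N (θ.toStage5₁₃CoP F N) P) → ∀ P : B12.RunParams, B15Leaf (θ.res.W P))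
    (P : B12.RunParams) : Dag.B15_main (leavesP w P) :=
  B15LeafKnit.b15_main_of_up (U := w.up P) rfl ((N24_forall_pinned_b15Leaf_iff₁₃CCoP h).1 slots₁₂ P)

/-! ## §1. (B2) at the Stage-13 record: the engine, and the children at θ by name -/

/-- **N24 · (B2) AT THE STAGE-13 RECORD — the composition ENGINE**: from the nine by-name binders N05 … N13 at every run of the world and the β-box
`w.b ≤ D.βfun ≤ w.βup` on `]0, γ₀]^{k+1}`, `γ₀ ≥ w.γ`: `B16.EndStatementBPrinted D.C`.  Module 5's `N24_at_record₅C` AT THE SHADOW `D₅` (`D₅.C = D.C` CONSUMED,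
`D₅.βfun = D.βfun`), N03 a theorem there (`N03_at_record₅C`), N01 N02 N04 inside. [cite: Balaban1989LargeFieldII, Thm 1 p.355 + pp.387, 391; Balaban1988Convergent, Thm 1 p.262, (0.2) p.244; Balaban1987RG1, (1.22) p.264 (bookkeeping over the Stage-13 record)] -/
theorem N24_at_record₁₃CCoP (h : IsRecordOfRecord₁₃CCoP F N D w) {γ₀ : ℝ} (hγ₀ : w.γ ≤ γ₀)
    (h05 : ∀ P : B12.RunParams, Dag.B8_main (leavesP w P)) (h06 : ∀ P : B12.RunParams, Dag.B9_main (leavesP w P))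
    (h07 : ∀ P : B12.RunParams, Dag.B11_main (leavesP w P)) (h08 : ∀ P : B12.RunParams, Dag.B10_main (leavesP w P))
    (h09 : ∀ P : B12.RunParams, Dag.B12_main (leavesP w P)) (h10 : ∀ P : B12.RunParams, Dag.B13_main (leavesP w P))
    (h11 : ∀ P : B12.RunParams, Dag.B14_main (leavesP w P)) (h12 : ∀ P : B12.RunParams, Dag.B15_main (leavesP w P))
    (h13 : ∀ P : B12.RunParams, Dag.B16_main (leavesP w P))
    (hlo : FlowStep.BetaLowerH w.b γ₀ D.βfun) (hhi : FlowStep.BetaUpperH w.βup γ₀ D.βfun) :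
    B16.EndStatementBPrinted D.C := by
  obtain ⟨D₅, h₅, hC5, -, hβ, -⟩ := exists_isRecordOfRecord₅C_of_isRecordOfRecord₁₃CCoP h
  have hlo' : FlowStep.BetaLowerH w.b γ₀ D₅.βfun := by rw [hβ]; exact hlo
  have hhi' : FlowStep.BetaUpperH w.βup γ₀ D₅.βfun := by rw [hβ]; exact hhi
  rw [← hC5]
  exact N24_at_record₅C h₅ hγ₀ (N03_at_record₅C h₅) h05 h06 h07 h08 h09 h10 h11 h12 h13 hlo' hhi'

/-- **The engine with N13 in its ∃-exponent form** («for SOME dependence letters `(e₋, e₊)`, N13 at every run of `{ w with em := e₋, ep := e₊ }`» — (B2) does not read the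
world's exponent letters; module 5's `N24_at_record₅C_of_N13_exists` at the shadow). [cite: Balaban1989LargeFieldII, Thm 1 p.355, (0.1) pp.355–356 («for some E₋, E₊»), p.391] -/
theorem N24_at_record₁₃CCoP_of_N13_exists (h : IsRecordOfRecord₁₃CCoP F N D w) {γ₀ : ℝ} (hγ₀ : w.γ ≤ γ₀)
    (h05 : ∀ P : B12.RunParams, Dag.B8_main (leavesP w P)) (h06 : ∀ P : B12.RunParams, Dag.B9_main (leavesP w P))
    (h07 : ∀ P : B12.RunParams, Dag.B11_main (leavesP w P)) (h08 : ∀ P : B12.RunParams, Dag.B10_main (leavesP w P))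
    (h09 : ∀ P : B12.RunParams, Dag.B12_main (leavesP w P)) (h10 : ∀ P : B12.RunParams, Dag.B13_main (leavesP w P))
    (h11 : ∀ P : B12.RunParams, Dag.B14_main (leavesP w P)) (h12 : ∀ P : B12.RunParams, Dag.B15_main (leavesP w P))
    (h13 : ∃ em ep : ℝ → ℝ, ∀ P : B12.RunParams, Dag.B16_main (leavesP { w with em := em, ep := ep } P))
    (hlo : FlowStep.BetaLowerH w.b γ₀ D.βfun) (hhi : FlowStep.BetaUpperH w.βup γ₀ D.βfun) :
    B16.EndStatementBPrinted D.C := by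
  obtain ⟨D₅, h₅, hC5, -, hβ, -⟩ := exists_isRecordOfRecord₅C_of_isRecordOfRecord₁₃CCoP h
  have hlo' : FlowStep.BetaLowerH w.b γ₀ D₅.βfun := by rw [hβ]; exact hlo
  have hhi' : FlowStep.BetaUpperH w.βup γ₀ D₅.βfun := by rw [hβ]; exact hhi
  rw [← hC5]
  exact N24_at_record₅C_of_N13_exists h₅ hγ₀ (N03_at_record₅C h₅) h05 h06 h07 h08 h09 h10 h11 h12 h13 hlo' hhi'

/-- **The engine with N13 WORLD-LEVEL**: the eight children N05 … N12 by name, and N13 from the record's 𝐑-leaf `hR : ∀ P, (w.up P).rOperation` together with «∃ (e₋, e₊) R,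
the five [Balaban1988Convergent] Cor.-3 leaves at `(D.C, w.γ)`» `hcor3` (seat dag-n13-a's `B16NodeKnitRecordPinned.b16_main_of_isRecordOfRecord₅C_of_leaf` at the shadow through
module 15's `N24_b16_main_withExp_of_cor3Leaves₅C`, `D₅.C = D.C` consumed by `rw`) — the form the carrier-chain sequel `Node00/N24KnitStage11Carriers` feeds.
[cite: Balaban1989LargeFieldII, Thm 1 p.355, (0.1) pp.355–356, p.387, p.391; Balaban1988Convergent, p.244, Cor. 3 (2.50) p.264 and pp.283–284 (bookkeeping over the Stage-13 record)] -/
theorem N24_at_record₁₃CCoP_of_N13_leaf (h : IsRecordOfRecord₁₃CCoP F N D w) {γ₀ : ℝ} (hγ₀ : w.γ ≤ γ₀)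
    (h05 : ∀ P : B12.RunParams, Dag.B8_main (leavesP w P)) (h06 : ∀ P : B12.RunParams, Dag.B9_main (leavesP w P))
    (h07 : ∀ P : B12.RunParams, Dag.B11_main (leavesP w P)) (h08 : ∀ P : B12.RunParams, Dag.B10_main (leavesP w P))
    (h09 : ∀ P : B12.RunParams, Dag.B12_main (leavesP w P)) (h10 : ∀ P : B12.RunParams, Dag.B13_main (leavesP w P))
    (h11 : ∀ P : B12.RunParams, Dag.B14_main (leavesP w P)) (h12 : ∀ P : B12.RunParams, Dag.B15_main (leavesP w P))
    (hR : ∀ P : B12.RunParams, (w.up P).rOperation)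
    (hcor3 : ∃ (em ep : ℝ → ℝ) (R : B14Cor3.ReprFamily D.C),
      B14Cor3.LeafH D.C R w.γ ∧ B14Cor3.LeafU1 D.C R w.γ ∧ B14Cor3.LeafU2 D.C R w.γ ep ∧ B14Cor3.LeafL1 D.C R w.γ ∧ B14Cor3.LeafL2 D.C R w.γ em)
    (hlo : FlowStep.BetaLowerH w.b γ₀ D.βfun) (hhi : FlowStep.BetaUpperH w.βup γ₀ D.βfun) :
    B16.EndStatementBPrinted D.C := by
  obtain ⟨D₅, h₅, hC5, -, hβ, -⟩ := exists_isRecordOfRecord₅C_of_isRecordOfRecord₁₃CCoP h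
  have hlo' : FlowStep.BetaLowerH w.b γ₀ D₅.βfun := by rw [hβ]; exact hlo
  have hhi' : FlowStep.BetaUpperH w.βup γ₀ D₅.βfun := by rw [hβ]; exact hhi
  rw [← hC5] at hcor3 ⊢
  obtain ⟨em, ep, R, hH, hU1, hU2, hL1, hL2⟩ := hcor3
  exact N24_at_record₅C_of_N13_exists h₅ hγ₀ (N03_at_record₅C h₅) h05 h06 h07 h08 h09 h10 h11 h12
    ⟨em, ep, N24_b16_main_withExp_of_cor3Leaves₅C h₅ hR em ep R hH hU1 hU2 hL1 hL2⟩ hlo' hhi'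

/-- **N24 · (B2) AT THE STAGE-13 RECORD, THE CARRIER CHILDREN AT THE RECORD'S OWN PARAMETERS BY NAME, N13 WORLD-LEVEL, N09 ∕ N11 BY-NAME BINDERS.**  N01 N02 N03 N04 theorems
(inside); N05 N06 N07 N12 θ-keyed pinned carrier sockets on the residual groups X ∕ Y ∕ Z ∕ W over `θ.toStage5₁₃CoP` (§0); N08 the leaf-system slot; N10 the B13
socket; **N13** the record's 𝐑-leaf `hR : ∀ P, (w.up P).rOperation` — at Stage 13 = «𝐓-image form ⇒ §2 form one level up» along the tower of record,
`∀ k < K, TLaw₁₃CoP θ P k → SLaw₁₃CoP θ P (k+1)` for the presenting `θ` (`Record12.rOperation_upOfRecord₅C_stage13CoP_iff`, the §2 [Balaban1988Convergent] format PINNED and REPAIRED) — and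
«∃ (e₋, e₊) R, the five [Balaban1988Convergent] Cor.-3 leaves at `(D.C, w.γ)`» `hcor3` (seat dag-n13-a's `B16NodeKnitRecordPinned.b16_main_of_isRecordOfRecord₅C_of_leaf` at the
shadow, `D₅.C = D.C` consumed); **N09, N11** by-name binders (their Stage-13 junctions — seat dag-n11-a's construction-generic `b14_main_at_construction_rhoOfRecord9_along` with the start `sLaw₁₃CoP_zero`, and N09's Thm-3 member along `gOfRecord₁₃` once the dag-n09 lane's canonical-transport plug exists — enter in the sequel `N24KnitStage13All`); β-box on `D.βfun` over `]0, γ₀]`.  THE HYPOTHESIS LIST IS «WHICH CHILD BLOCKS AT ₁₃C» IN KERNEL FORM.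
[cite: Balaban1989LargeFieldII, Thm 1 p.355, (0.1) pp.355–356, p.387, p.391; Balaban1988Convergent, Thm 1 p.262, Cor. 3 pp.283–284, p.244; Balaban1987RG1, Thm 3 p.264, (1.22) p.264; Balaban1985RegularSpaces, Thms 2, 4, 8 pp.83–101; Balaban1985BackgroundPropagators, Thms 3.1–3.15 pp.397–432; Balaban1985Variational, Thm 1 p.279; Balaban1985UV3, Thm 1 p.257 + Thm 2 p.272; Balaban1988RG2Cluster, Lemmas 1–3 pp.9, 11, 20; Balaban1989LargeFieldI, Prop. 1 p.194; Balaban1984PropagatorsII, pp.234–249 (bookkeeping over the Stage-13 record)] -/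
theorem N24_at_record₁₃CCoP_knit_pinned (h : IsRecordOfRecord₁₃CCoP F N D w) {γ₀ : ℝ} (hγ₀ : w.γ ≤ γ₀)
    (slots₀₅ : ∀ (θ : Stage13Params F N) (hP : θ.Provisos₁₃Core F N), θ.Admissible F N → D = datumOfRecord₁₃CoP F N θ hP →
      (∀ P, w.up P = upOfRecord₅C F N (θ.toStage5₁₃CoP F N) P) → ∀ P : B12.RunParams,
        B8LeafR (θ.res.X P).d8 (θ.res.X P).L8 (θ.res.X P).C₂ (θ.res.X P).B₁' (θ.res.X P).B₀' (θ.res.X P).B₁ (θ.res.X P).B₂ (θ.res.X P).c₁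
          (θ.res.X P).inp8 (θ.res.X P).B₀β (θ.res.X P).loc8 (θ.res.X P).fam8R (θ.res.X P).lan8 (θ.res.X P).cub8 (θ.res.X P).toAxial8)
    (slots₀₆ : ∀ (θ : Stage13Params F N) (hP : θ.Provisos₁₃Core F N), θ.Admissible F N → D = datumOfRecord₁₃CoP F N θ hP →
      (∀ P, w.up P = upOfRecord₅C F N (θ.toStage5₁₃CoP F N) P) → ∀ P : B12.RunParams, B9LeafX (θ.res.Y P))
    (slots₀₇ : ∀ (θ : Stage13Params F N) (hP : θ.Provisos₁₃Core F N), θ.Admissible F N → D = datumOfRecord₁₃CoP F N θ hP →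
      (∀ P, w.up P = upOfRecord₅C F N (θ.toStage5₁₃CoP F N) P) → ∀ P : B12.RunParams, B11Leaf (θ.res.Z P))
    (slots₀₈ : ∀ (θ : Stage13Params F N) (hP : θ.Provisos₁₃Core F N), θ.Admissible F N → D = datumOfRecord₁₃CoP F N θ hP →
      (∀ P, w.up P = upOfRecord₅C F N (θ.toStage5₁₃CoP F N) P) → ∀ P : B12.RunParams,
        ∃ (Xc : PrintedCarriersR) (I : Type) (C : B10Assembly.Consts) (T : I → B10.TowerRun),
          Nonempty (∀ i, B10Assembly.LeafSystem C (T i)) ∧ θ.res.X P = Xc.withTowerRuns10 T)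
    (h09 : ∀ P : B12.RunParams, Dag.B12_main (leavesP w P))
    (slots₁₀ : ∀ (θ : Stage13Params F N) (hP : θ.Provisos₁₃Core F N), θ.Admissible F N → D = datumOfRecord₁₃CoP F N θ hP →
      (∀ P, w.up P = upOfRecord₅C F N (θ.toStage5₁₃CoP F N) P) → ∀ P : B12.RunParams,
        B9LeafX (θ.res.Y P) →
          (B10.Thm1PrintedCompact (θ.res.X P).runs10 ∧ B10.Thm2Printed (θ.res.X P).runs10) →
            B11Leaf (θ.res.Z P) → B12Sec2to5.Lemma4Printed (θ.res.X P).F12 (θ.res.X P).c12 →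
              B13.Lemma1Printed (θ.res.X P).S13 (θ.res.X P).c13 ∧ B13.Lemma2Printed (θ.res.X P).S13 (θ.res.X P).c13 ∧
                B13.Lemma3Printed (θ.res.X P).S13 (θ.res.X P).c13)
    (h11 : ∀ P : B12.RunParams, Dag.B14_main (leavesP w P))
    (slots₁₂ : ∀ (θ : Stage13Params F N) (hP : θ.Provisos₁₃Core F N), θ.Admissible F N → D = datumOfRecord₁₃CoP F N θ hP →
      (∀ P, w.up P = upOfRecord₅C F N (θ.toStage5₁₃CoP F N) P) → ∀ P : B12.RunParams, B15Leaf (θ.res.W P))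
    (hR : ∀ P : B12.RunParams, (w.up P).rOperation)
    (hcor3 : ∃ (em ep : ℝ → ℝ) (R : B14Cor3.ReprFamily D.C),
      B14Cor3.LeafH D.C R w.γ ∧ B14Cor3.LeafU1 D.C R w.γ ∧ B14Cor3.LeafU2 D.C R w.γ ep ∧ B14Cor3.LeafL1 D.C R w.γ ∧ B14Cor3.LeafL2 D.C R w.γ em)
    (hlo : FlowStep.BetaLowerH w.b γ₀ D.βfun) (hhi : FlowStep.BetaUpperH w.βup γ₀ D.βfun) :
    B16.EndStatementBPrinted D.C :=
  N24_at_record₁₃CCoP_of_N13_leaf h hγ₀ (N24_b8_main_of_isRecordOfRecord₁₃CCoP_of_slot h slots₀₅) (N24_b9_main_of_isRecordOfRecord₁₃CCoP_of_slot h slots₀₆)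
    (N24_b11_main_of_isRecordOfRecord₁₃CCoP_of_slot h slots₀₇) (N24_b10_main_of_isRecordOfRecord₁₃CCoP_of_slot h slots₀₈) h09
    (N24_b13_main_of_isRecordOfRecord₁₃CCoP_of_slot h slots₁₀) h11 (N24_b15_main_of_isRecordOfRecord₁₃CCoP_of_slot h slots₁₂) hR hcor3 hlo hhi

/-! ## §2. The β OF RECORD AT A CORE-KEYED Co STAGE-13 PRESENTATION READ AT THE MERGED β OVER `(TcanOfRecord, chiFixed29)` (the (T, χ)-generic iffs are module 37's, BY NAME) -/

/-- **At a Stage-13 presentation `D = datumOfRecord₁₃CoP F N θ hP`, `γ' ≤ θ.γ`: a LOWER box bound on `D.βfun` IS the same bound on the MERGED β over the continuous-version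
transport and the (2.9) species** — `D.βfun = betaOfRecord₁₃ θ = betaOfRecord₈Tχ (TcanOfRecord) (chiFixed29 θ.ν θ.ε₂₉) θ.toStage8Params` (node00-def-T's faces `βfun_datumOfRecord₁₃CoP`,
`betaOfRecord₁₃_eq_betaOfRecord₈Tχ`, both `rfl`); the (T, χ)-generic iff above does the rest.  β-VERSION at Stage 13: NO transport-regularity proviso — the canonical version's
good properties are node00-def-T's unconditional theorems (`Record13` §8).
[cite: Balaban1987RG1, (0.19) p.255, (1.20)–(1.22) p.264, (2.12)–(2.14) p.268 (bookkeeping)] -/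
theorem N24_betaLowerH_iff_merged₁₃CoP (θ : Stage13Params F N) (hP : θ.Provisos₁₃Core F N) (hD : D = datumOfRecord₁₃CoP F N θ hP) {γ' b : ℝ} (hγ' : γ' ≤ θ.γ) :
    FlowStep.BetaLowerH b γ' D.βfun ↔
      (letI := θ.instVβ₁; letI := θ.instVβ₂; letI := θ.instιβ
       FlowStep.BetaLowerH b γ' (betaMerged F (mergedTermFamilyMatT F N (TcanOfRecord F N) (chiFixed29 F N θ.ν θ.ε₂₉) θ.εbg) θ.ρ8 θ.bV)) := by
  have hβ : D.βfun = betaOfRecord₈Tχ F N (TcanOfRecord F N) (chiFixed29 F N θ.ν θ.ε₂₉) θ.toStage8Params := by rw [hD]; rfl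
  rw [hβ]
  exact N24_betaLowerH_iff_mergedTχ (TcanOfRecord F N) (chiFixed29 F N θ.ν θ.ε₂₉) θ.toStage8Params hγ'

/-- **The same for an UPPER box bound** at a Stage-13 presentation. [cite: Balaban1987RG1, (0.19) p.255, (1.20)–(1.22) p.264, (2.12)–(2.14) p.268 (bookkeeping)] -/
theorem N24_betaUpperH_iff_merged₁₃CoP (θ : Stage13Params F N) (hP : θ.Provisos₁₃Core F N) (hD : D = datumOfRecord₁₃CoP F N θ hP) {γ' β' : ℝ} (hγ' : γ' ≤ θ.γ) :
    FlowStep.BetaUpperH β' γ' D.βfun ↔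
      (letI := θ.instVβ₁; letI := θ.instVβ₂; letI := θ.instιβ
       FlowStep.BetaUpperH β' γ' (betaMerged F (mergedTermFamilyMatT F N (TcanOfRecord F N) (chiFixed29 F N θ.ν θ.ε₂₉) θ.εbg) θ.ρ8 θ.bV)) := by
  have hβ : D.βfun = betaOfRecord₈Tχ F N (TcanOfRecord F N) (chiFixed29 F N θ.ν θ.ε₂₉) θ.toStage8Params := by rw [hD]; rfl
  rw [hβ]
  exact N24_betaUpperH_iff_mergedTχ (TcanOfRecord F N) (chiFixed29 F N θ.ν θ.ε₂₉) θ.toStage8Params hγ'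

/-- **N24 · (B2) at the Stage-13 record, the children as in `N24_at_record₁₃CCoP_knit_pinned`, with the β-binders READ AT THE MERGED β over `(TcanOfRecord, chiFixed29 θ.ν θ.ε₂₉)` along the world's own box `]0, w.γ]^{k+1}`** (§2's iffs at the record's presenting `θ`).  WHICH CHILD BLOCKS at ₁₃CCoP, kernel form: the hypothesis list —
six residual-carrier sockets ∕ slots (X-[B8] ∕ [B10] ∕ B13, Y, Z, W — all residual again at ₁₃ until node00-def re-instantiates the carrier chain `Record13Carriers…` on
`Stage13Params`), N13's 𝐑-leaf (= «𝐓-image form ⇒ §2 form», repaired format) and Cor.-3 leaves, the by-name binders N09 and N11 (their Stage-13 faces pending), and two bounds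
on the merged β over `(TcanOfRecord, chiFixed29)` (lower `b > 0` UNPRINTED, T09.F = NODE O — the β-side definer's binder; upper β⁺ [Balaban1987RG1] p. 264).  β-VERSION (RIDER №6, inherited
from Stage 10):
canonical-version transport, (2.9) χ species; β-side binders are bounds on THIS β.
[cite: Balaban1989LargeFieldII, Thm 1 p.355, (0.1) pp.355–356, p.387, p.391; Balaban1987RG1, (0.19) p.255, (1.20)–(1.22) p.264, (2.12)–(2.14) p.268, Thm 3 p.264; Balaban1988Convergent, Thm 1 p.262, Cor. 3 pp.283–284, p.244 (bookkeeping over the Stage-13 record)] -/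
theorem N24_at_record₁₃CCoP_knit_of_betaMerged_pinned (h : IsRecordOfRecord₁₃CCoP F N D w)
    (slots₀₅ : ∀ (θ : Stage13Params F N) (hP : θ.Provisos₁₃Core F N), θ.Admissible F N → D = datumOfRecord₁₃CoP F N θ hP →
      (∀ P, w.up P = upOfRecord₅C F N (θ.toStage5₁₃CoP F N) P) → ∀ P : B12.RunParams,
        B8LeafR (θ.res.X P).d8 (θ.res.X P).L8 (θ.res.X P).C₂ (θ.res.X P).B₁' (θ.res.X P).B₀' (θ.res.X P).B₁ (θ.res.X P).B₂ (θ.res.X P).c₁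
          (θ.res.X P).inp8 (θ.res.X P).B₀β (θ.res.X P).loc8 (θ.res.X P).fam8R (θ.res.X P).lan8 (θ.res.X P).cub8 (θ.res.X P).toAxial8)
    (slots₀₆ : ∀ (θ : Stage13Params F N) (hP : θ.Provisos₁₃Core F N), θ.Admissible F N → D = datumOfRecord₁₃CoP F N θ hP →
      (∀ P, w.up P = upOfRecord₅C F N (θ.toStage5₁₃CoP F N) P) → ∀ P : B12.RunParams, B9LeafX (θ.res.Y P))
    (slots₀₇ : ∀ (θ : Stage13Params F N) (hP : θ.Provisos₁₃Core F N), θ.Admissible F N → D = datumOfRecord₁₃CoP F N θ hP →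
      (∀ P, w.up P = upOfRecord₅C F N (θ.toStage5₁₃CoP F N) P) → ∀ P : B12.RunParams, B11Leaf (θ.res.Z P))
    (slots₀₈ : ∀ (θ : Stage13Params F N) (hP : θ.Provisos₁₃Core F N), θ.Admissible F N → D = datumOfRecord₁₃CoP F N θ hP →
      (∀ P, w.up P = upOfRecord₅C F N (θ.toStage5₁₃CoP F N) P) → ∀ P : B12.RunParams,
        ∃ (Xc : PrintedCarriersR) (I : Type) (C : B10Assembly.Consts) (T : I → B10.TowerRun),
          Nonempty (∀ i, B10Assembly.LeafSystem C (T i)) ∧ θ.res.X P = Xc.withTowerRuns10 T)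
    (h09 : ∀ P : B12.RunParams, Dag.B12_main (leavesP w P))
    (slots₁₀ : ∀ (θ : Stage13Params F N) (hP : θ.Provisos₁₃Core F N), θ.Admissible F N → D = datumOfRecord₁₃CoP F N θ hP →
      (∀ P, w.up P = upOfRecord₅C F N (θ.toStage5₁₃CoP F N) P) → ∀ P : B12.RunParams,
        B9LeafX (θ.res.Y P) →
          (B10.Thm1PrintedCompact (θ.res.X P).runs10 ∧ B10.Thm2Printed (θ.res.X P).runs10) →
            B11Leaf (θ.res.Z P) → B12Sec2to5.Lemma4Printed (θ.res.X P).F12 (θ.res.X P).c12 →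
              B13.Lemma1Printed (θ.res.X P).S13 (θ.res.X P).c13 ∧ B13.Lemma2Printed (θ.res.X P).S13 (θ.res.X P).c13 ∧
                B13.Lemma3Printed (θ.res.X P).S13 (θ.res.X P).c13)
    (h11 : ∀ P : B12.RunParams, Dag.B14_main (leavesP w P))
    (slots₁₂ : ∀ (θ : Stage13Params F N) (hP : θ.Provisos₁₃Core F N), θ.Admissible F N → D = datumOfRecord₁₃CoP F N θ hP →
      (∀ P, w.up P = upOfRecord₅C F N (θ.toStage5₁₃CoP F N) P) → ∀ P : B12.RunParams, B15Leaf (θ.res.W P))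
    (hR : ∀ P : B12.RunParams, (w.up P).rOperation)
    (hcor3 : ∃ (em ep : ℝ → ℝ) (R : B14Cor3.ReprFamily D.C),
      B14Cor3.LeafH D.C R w.γ ∧ B14Cor3.LeafU1 D.C R w.γ ∧ B14Cor3.LeafU2 D.C R w.γ ep ∧ B14Cor3.LeafL1 D.C R w.γ ∧ B14Cor3.LeafL2 D.C R w.γ em)
    (hβm : ∀ (θ : Stage13Params F N) (hP : θ.Provisos₁₃Core F N), θ.Admissible F N → D = datumOfRecord₁₃CoP F N θ hP → w.γ ≤ θ.γ →
      letI := θ.instVβ₁; letI := θ.instVβ₂; letI := θ.instιβ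
      FlowStep.BetaLowerH w.b w.γ (betaMerged F (mergedTermFamilyMatT F N (TcanOfRecord F N) (chiFixed29 F N θ.ν θ.ε₂₉) θ.εbg) θ.ρ8 θ.bV) ∧
        FlowStep.BetaUpperH w.βup w.γ (betaMerged F (mergedTermFamilyMatT F N (TcanOfRecord F N) (chiFixed29 F N θ.ν θ.ε₂₉) θ.εbg) θ.ρ8 θ.bV)) :
    B16.EndStatementBPrinted D.C := by
  obtain ⟨θ, hP, hθ, hD, -, hγ, -, -⟩ := id h
  obtain ⟨hlo, hhi⟩ := hβm θ hP hθ hD hγ.2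
  exact N24_at_record₁₃CCoP_knit_pinned h le_rfl slots₀₅ slots₀₆ slots₀₇ slots₀₈ h09 slots₁₀ h11 slots₁₂ hR hcor3
    ((N24_betaLowerH_iff_merged₁₃CoP θ hP hD hγ.2).mpr hlo) ((N24_betaUpperH_iff_merged₁₃CoP θ hP hD hγ.2).mpr hhi)

/-! ## §3. The K1-class item body (every edition's K1-class item, read at `.toCore`) in its expected literal (D, w)-shape at a CORE Stage-13 record -/

/-- **The (D, w)-CONSEQUENT of the K1-class ₁₃ item (every edition's K1-class item read at `.toCore`; (D, w)-body = K1's verbatim with `IsRecordOfRecord₁₃CCoP`) in its LITERAL SHAPE at general `N`,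
WITNESSED BY THE RECORD AT HAND**, children as in `N24_at_record₁₃CCoP_knit_pinned`: `IsRecordOfRecord₁₃CCoP F N D w ∧ B16.EndStatementBPrinted D.C ∧ ∃ γ₁ > 0, ∀ γ ∈ ]0, γ₁], ∃ P, 1 ≤ P.K ∧
(D.C P).flow.InInterval γ P.K` — the record clause is `h` itself, (B2) by §1, `γ₁ := γ₀` and the run `⟨K, m, g₀⟩` of module 8's K-indexed window at ANY length `K ≥ 1`
(`N24_window_allK_of_betaUpperH`, from `hhi` alone: the datum's flow is forward-generated, dictionary field `D.fwd`) — the «K ≥ 1» non-vacuity clause of the restated item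
is met by choosing the length.  COMPOSITE: this is (B2) GIVEN the children; nothing is discharged. [cite: Balaban1989LargeFieldII, Thm 1 p.355 + p.391; Balaban1987RG1, (0.17)–(0.20) pp.255–256 and p.264 (bookkeeping + elementary window)] -/
theorem N24_stabilityBR13_shape₁₃CCoP_knit_pinned (h : IsRecordOfRecord₁₃CCoP F N D w) {γ₀ : ℝ} (hγ₀ : w.γ ≤ γ₀) {K : ℕ} (hK : 1 ≤ K) (m : ℕ)
    (slots₀₅ : ∀ (θ : Stage13Params F N) (hP : θ.Provisos₁₃Core F N), θ.Admissible F N → D = datumOfRecord₁₃CoP F N θ hP →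
      (∀ P, w.up P = upOfRecord₅C F N (θ.toStage5₁₃CoP F N) P) → ∀ P : B12.RunParams,
        B8LeafR (θ.res.X P).d8 (θ.res.X P).L8 (θ.res.X P).C₂ (θ.res.X P).B₁' (θ.res.X P).B₀' (θ.res.X P).B₁ (θ.res.X P).B₂ (θ.res.X P).c₁
          (θ.res.X P).inp8 (θ.res.X P).B₀β (θ.res.X P).loc8 (θ.res.X P).fam8R (θ.res.X P).lan8 (θ.res.X P).cub8 (θ.res.X P).toAxial8)
    (slots₀₆ : ∀ (θ : Stage13Params F N) (hP : θ.Provisos₁₃Core F N), θ.Admissible F N → D = datumOfRecord₁₃CoP F N θ hP →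
      (∀ P, w.up P = upOfRecord₅C F N (θ.toStage5₁₃CoP F N) P) → ∀ P : B12.RunParams, B9LeafX (θ.res.Y P))
    (slots₀₇ : ∀ (θ : Stage13Params F N) (hP : θ.Provisos₁₃Core F N), θ.Admissible F N → D = datumOfRecord₁₃CoP F N θ hP →
      (∀ P, w.up P = upOfRecord₅C F N (θ.toStage5₁₃CoP F N) P) → ∀ P : B12.RunParams, B11Leaf (θ.res.Z P))
    (slots₀₈ : ∀ (θ : Stage13Params F N) (hP : θ.Provisos₁₃Core F N), θ.Admissible F N → D = datumOfRecord₁₃CoP F N θ hP →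
      (∀ P, w.up P = upOfRecord₅C F N (θ.toStage5₁₃CoP F N) P) → ∀ P : B12.RunParams,
        ∃ (Xc : PrintedCarriersR) (I : Type) (C : B10Assembly.Consts) (T : I → B10.TowerRun),
          Nonempty (∀ i, B10Assembly.LeafSystem C (T i)) ∧ θ.res.X P = Xc.withTowerRuns10 T)
    (h09 : ∀ P : B12.RunParams, Dag.B12_main (leavesP w P))
    (slots₁₀ : ∀ (θ : Stage13Params F N) (hP : θ.Provisos₁₃Core F N), θ.Admissible F N → D = datumOfRecord₁₃CoP F N θ hP →
      (∀ P, w.up P = upOfRecord₅C F N (θ.toStage5₁₃CoP F N) P) → ∀ P : B12.RunParams,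
        B9LeafX (θ.res.Y P) →
          (B10.Thm1PrintedCompact (θ.res.X P).runs10 ∧ B10.Thm2Printed (θ.res.X P).runs10) →
            B11Leaf (θ.res.Z P) → B12Sec2to5.Lemma4Printed (θ.res.X P).F12 (θ.res.X P).c12 →
              B13.Lemma1Printed (θ.res.X P).S13 (θ.res.X P).c13 ∧ B13.Lemma2Printed (θ.res.X P).S13 (θ.res.X P).c13 ∧
                B13.Lemma3Printed (θ.res.X P).S13 (θ.res.X P).c13)
    (h11 : ∀ P : B12.RunParams, Dag.B14_main (leavesP w P))
    (slots₁₂ : ∀ (θ : Stage13Params F N) (hP : θ.Provisos₁₃Core F N), θ.Admissible F N → D = datumOfRecord₁₃CoP F N θ hP →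
      (∀ P, w.up P = upOfRecord₅C F N (θ.toStage5₁₃CoP F N) P) → ∀ P : B12.RunParams, B15Leaf (θ.res.W P))
    (hR : ∀ P : B12.RunParams, (w.up P).rOperation)
    (hcor3 : ∃ (em ep : ℝ → ℝ) (R : B14Cor3.ReprFamily D.C),
      B14Cor3.LeafH D.C R w.γ ∧ B14Cor3.LeafU1 D.C R w.γ ∧ B14Cor3.LeafU2 D.C R w.γ ep ∧ B14Cor3.LeafL1 D.C R w.γ ∧ B14Cor3.LeafL2 D.C R w.γ em)
    (hlo : FlowStep.BetaLowerH w.b γ₀ D.βfun) (hhi : FlowStep.BetaUpperH w.βup γ₀ D.βfun) :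
    IsRecordOfRecord₁₃CCoP F N D w ∧ B16.EndStatementBPrinted D.C ∧
      ∃ γ₁ : ℝ, 0 < γ₁ ∧ ∀ γ : ℝ, 0 < γ → γ ≤ γ₁ → ∃ P : B12.RunParams, 1 ≤ P.K ∧ (D.C P).flow.InInterval γ P.K := by
  refine ⟨h, N24_at_record₁₃CCoP_knit_pinned h hγ₀ slots₀₅ slots₀₆ slots₀₇ slots₀₈ h09 slots₁₀ h11 slots₁₂ hR hcor3 hlo hhi,
    γ₀, (gamma_pos_of_isRecordOfRecord₁₃CCoP h).trans_le hγ₀, fun γ hγ hγle => ?_⟩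
  obtain ⟨g0, -, hrun⟩ := N24_window_allK_of_betaUpperH D hhi hγ hγle m K
  exact ⟨⟨K, m, g0⟩, hK, hrun⟩

/-- **… and in the item's ∃-form** `∃ D w, IsRecordOfRecord₁₃CCoP F N D w ∧ (B) ∧ window(K ≥ 1)` — the (D, w)-consequent of the K1-class ₁₃ item's expected text at general `N` (the route
instantiates `F`, `N := 2`), from ONE Stage-13 record whose children hold: the composite's «closes with N01–N13 + the β-window» sentence in kernel form.
[cite: Balaban1989LargeFieldII, Thm 1 p.355 + p.391; Balaban1987RG1, (0.17)–(0.20) pp.255–256 (bookkeeping)] -/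
theorem N24_stabilityBR13_consequent₁₃CCoP_knit_pinned (h : IsRecordOfRecord₁₃CCoP F N D w) {γ₀ : ℝ} (hγ₀ : w.γ ≤ γ₀)
    (slots₀₅ : ∀ (θ : Stage13Params F N) (hP : θ.Provisos₁₃Core F N), θ.Admissible F N → D = datumOfRecord₁₃CoP F N θ hP →
      (∀ P, w.up P = upOfRecord₅C F N (θ.toStage5₁₃CoP F N) P) → ∀ P : B12.RunParams,
        B8LeafR (θ.res.X P).d8 (θ.res.X P).L8 (θ.res.X P).C₂ (θ.res.X P).B₁' (θ.res.X P).B₀' (θ.res.X P).B₁ (θ.res.X P).B₂ (θ.res.X P).c₁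
          (θ.res.X P).inp8 (θ.res.X P).B₀β (θ.res.X P).loc8 (θ.res.X P).fam8R (θ.res.X P).lan8 (θ.res.X P).cub8 (θ.res.X P).toAxial8)
    (slots₀₆ : ∀ (θ : Stage13Params F N) (hP : θ.Provisos₁₃Core F N), θ.Admissible F N → D = datumOfRecord₁₃CoP F N θ hP →
      (∀ P, w.up P = upOfRecord₅C F N (θ.toStage5₁₃CoP F N) P) → ∀ P : B12.RunParams, B9LeafX (θ.res.Y P))
    (slots₀₇ : ∀ (θ : Stage13Params F N) (hP : θ.Provisos₁₃Core F N), θ.Admissible F N → D = datumOfRecord₁₃CoP F N θ hP →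
      (∀ P, w.up P = upOfRecord₅C F N (θ.toStage5₁₃CoP F N) P) → ∀ P : B12.RunParams, B11Leaf (θ.res.Z P))
    (slots₀₈ : ∀ (θ : Stage13Params F N) (hP : θ.Provisos₁₃Core F N), θ.Admissible F N → D = datumOfRecord₁₃CoP F N θ hP →
      (∀ P, w.up P = upOfRecord₅C F N (θ.toStage5₁₃CoP F N) P) → ∀ P : B12.RunParams,
        ∃ (Xc : PrintedCarriersR) (I : Type) (C : B10Assembly.Consts) (T : I → B10.TowerRun),
          Nonempty (∀ i, B10Assembly.LeafSystem C (T i)) ∧ θ.res.X P = Xc.withTowerRuns10 T)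
    (h09 : ∀ P : B12.RunParams, Dag.B12_main (leavesP w P))
    (slots₁₀ : ∀ (θ : Stage13Params F N) (hP : θ.Provisos₁₃Core F N), θ.Admissible F N → D = datumOfRecord₁₃CoP F N θ hP →
      (∀ P, w.up P = upOfRecord₅C F N (θ.toStage5₁₃CoP F N) P) → ∀ P : B12.RunParams,
        B9LeafX (θ.res.Y P) →
          (B10.Thm1PrintedCompact (θ.res.X P).runs10 ∧ B10.Thm2Printed (θ.res.X P).runs10) →
            B11Leaf (θ.res.Z P) → B12Sec2to5.Lemma4Printed (θ.res.X P).F12 (θ.res.X P).c12 →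
              B13.Lemma1Printed (θ.res.X P).S13 (θ.res.X P).c13 ∧ B13.Lemma2Printed (θ.res.X P).S13 (θ.res.X P).c13 ∧
                B13.Lemma3Printed (θ.res.X P).S13 (θ.res.X P).c13)
    (h11 : ∀ P : B12.RunParams, Dag.B14_main (leavesP w P))
    (slots₁₂ : ∀ (θ : Stage13Params F N) (hP : θ.Provisos₁₃Core F N), θ.Admissible F N → D = datumOfRecord₁₃CoP F N θ hP →
      (∀ P, w.up P = upOfRecord₅C F N (θ.toStage5₁₃CoP F N) P) → ∀ P : B12.RunParams, B15Leaf (θ.res.W P))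
    (hR : ∀ P : B12.RunParams, (w.up P).rOperation)
    (hcor3 : ∃ (em ep : ℝ → ℝ) (R : B14Cor3.ReprFamily D.C),
      B14Cor3.LeafH D.C R w.γ ∧ B14Cor3.LeafU1 D.C R w.γ ∧ B14Cor3.LeafU2 D.C R w.γ ep ∧ B14Cor3.LeafL1 D.C R w.γ ∧ B14Cor3.LeafL2 D.C R w.γ em)
    (hlo : FlowStep.BetaLowerH w.b γ₀ D.βfun) (hhi : FlowStep.BetaUpperH w.βup γ₀ D.βfun) :
    ∃ (D' : FiniteEpsData F (SU N)) (w' : WorldP), IsRecordOfRecord₁₃CCoP F N D' w' ∧ B16.EndStatementBPrinted D'.C ∧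
      ∃ γ₁ : ℝ, 0 < γ₁ ∧ ∀ γ : ℝ, 0 < γ → γ ≤ γ₁ → ∃ P : B12.RunParams, 1 ≤ P.K ∧ (D'.C P).flow.InInterval γ P.K :=
  ⟨D, w, N24_stabilityBR13_shape₁₃CCoP_knit_pinned h hγ₀ le_rfl 0 slots₀₅ slots₀₆ slots₀₇ slots₀₈ h09 slots₁₀ h11 slots₁₂ hR hcor3 hlo hhi⟩

/-! ## §4. ₁₃CCoP is closed under γ-lowering re-lettering of the world (the `hRL` of design E) -/

/-- **Re-lettering a Stage-13 record's world** — new interval letter `γ' ∈ ]0, w.γ]`, any lower letter `b' > 0`, any upper letter `βup'`, any exponent letters `(e₋, e₊)`,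
same `C`, `up`, `L` — gives again a Stage-13 record over the SAME datum (the window clause is `0 < w.γ ≤ θ.γ`; nothing else reads a world letter).  The `hRL` hypothesis
of the design-E faces (module 7) for `Rec := IsRecordOfRecord₁₃CCoP` — NOT instantiated (X, Y, Z, W residual at Stage 13 until node00-def's `Record13Carriers…`).
[cite: Balaban1989LargeFieldII, Thm 1 p.355 («γ sufficiently small»; bookkeeping)] -/
theorem N24_isRecordOfRecord₁₃CCoP_reletter (h : IsRecordOfRecord₁₃CCoP F N D w) {γ' b' : ℝ} (hγ' : 0 < γ') (hγ'le : γ' ≤ w.γ) (hb' : 0 < b') (βup' : ℝ)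
    (em ep : ℝ → ℝ) :
    IsRecordOfRecord₁₃CCoP F N D { w with γ := γ', b := b', b_pos := hb', βup := βup', em := em, ep := ep } := by
  obtain ⟨θ, hP, hθ, hD, hC, hγ, hL, hup⟩ := h
  exact ⟨θ, hP, hθ, hD, hC, ⟨hγ', hγ'le.trans hγ.2⟩, hL, hup⟩

/-! ## §5. The socket display is strength-neutral at ₁₃CCoP -/

/-- **LOGICAL STATUS of the socket display at a Stage-13 record** (module 14's `N24_leaves_iff_binders₅C` through the shadow): GIVEN N08, the four world leaves
`b8 ∧ b9 ∧ b11 ∧ rBasicStep` at every run (⇔ the four θ-keyed sockets of §0) are EQUIVALENT to the four by-name binders N05 ∧ N06 ∧ N07 ∧ N12 — replacing binders by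
sockets is census-NEUTRAL in strength and census-POSITIVE in location. [cite: Balaban1985RegularSpaces, Thm 8 p.101; Balaban1985BackgroundPropagators, Thm 3.15 p.432; Balaban1985Variational, Thm 1 p.279; Balaban1989LargeFieldI, Prop. 1 p.194 (bookkeeping)] -/
theorem N24_leaves_iff_binders₁₃CCoP (h : IsRecordOfRecord₁₃CCoP F N D w) (h08 : ∀ P : B12.RunParams, Dag.B10_main (leavesP w P)) :
    ((∀ P : B12.RunParams, (w.up P).b8) ∧ (∀ P : B12.RunParams, (w.up P).b9) ∧ (∀ P : B12.RunParams, (w.up P).b11) ∧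
        ∀ P : B12.RunParams, (w.up P).rBasicStep) ↔
      ((∀ P : B12.RunParams, Dag.B8_main (leavesP w P)) ∧ (∀ P : B12.RunParams, Dag.B9_main (leavesP w P)) ∧
        (∀ P : B12.RunParams, Dag.B11_main (leavesP w P)) ∧ ∀ P : B12.RunParams, Dag.B15_main (leavesP w P)) := by
  obtain ⟨D₅, h₅, -⟩ := exists_isRecordOfRecord₅C_of_isRecordOfRecord₁₃CCoP h
  exact N24_leaves_iff_binders₅C h₅ h08

end Literature.MathematicalPhysics.QuantumFieldTheory.Balaban1983to89.Node00

end
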